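import Literature.NumberTheory.Sieve.CFCongruenceTransferOperator
import HarnessLib

/-!
# Smoothing: `C¹(I)` operator bounds imply Lipschitz bounds (Magee–Oh–Winter, Theorem 4 framework)

Support file (all results proved) for the reduction of the named fact
`Literature.NumberTheory.Sieve.MageeOhWinter2019_uniformCounting` to [MageeOhWinter2019, Thm. 4].
Theorem 4 bounds the congruence transfer operators `𝓛^m_{s,q}` in the operator norm of
`C¹(I; ℂ^{Γ_q})` (eq. (2.3)), whereas the tree's renewal machinery (`CfLip`, `cfTwist`) lives on
Lipschitz functions. This file proves the (standard) passage: an operator-norm bound for `𝓛^m_{s,q}` on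
`C¹(I)` gives the same bound, up to a factor `2` in the way the constants are split, for piecewise
Lipschitz functions on `I = ⋃ I_{a,a'}`.

* `steklov l r f ε`: the Steklov average `x ↦ ε⁻¹ ∫_x^{x+ε} f(π_{[l,r]} t) dt` of a function composed
  with the projection onto `[l,r]`; it is `C¹` on `ℝ`, bounded by `sup |f|`, has derivative bounded by
  the Lipschitz constant of `f` on `[l,r]`, and converges to `f` on `[l,r]` as `ε → 0`
  (`contDiff_steklov`, `norm_steklov_le`, `norm_deriv_steklov_le`, `norm_steklov_sub_le`).
* `cfSteklov`: the cylinderwise Steklov average on `I` (`C¹` on `I`, same bounds, `cfSteklov_tendsto`).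
* `contDiffOn_cfCongL`, `contDiffOn_cfCongL_iterate`: `𝓛_{s,q}` preserves `C¹(I; ℂ^{Γ_q})`.
* `cfCongL_iterate_pLip_of_c1`: **if `‖𝓛^m_{s,q} F‖_{C¹(I)} ≤ B ‖F‖_{C¹(I)}` for all `F ∈ C¹(I; ℂ^{Γ_q})`
  (resp. all such `F` with values orthogonal to the constants), then for every piecewise Lipschitz `f`
  on `I` with `sup_I ‖f‖ ≤ M` and cylinderwise Lipschitz constant `≤ L` (resp. and `Σ_ξ f(x)_ξ = 0` on
  `I`), `sup_I ‖𝓛^m f‖ ≤ B (M + L)` and `𝓛^m f` is cylinderwise `B (M + L)`-Lipschitz.**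

## References

* [MageeOhWinter2019] M. Magee, H. Oh, D. Winter, J. reine angew. Math. 753 (2019) 89–135, Thm. 4,
  eq. (2.3), §2.1 (II).
-/

noncomputable section

open Set Filter MeasureTheory intervalIntegral
open scoped MatrixGroups Topology

namespace Literature.NumberTheory.Sieve

/-! ### The Steklov average on an interval -/

section Steklov

variable {E : Type*} [NormedAddCommGroup E] [NormedSpace ℝ E] [CompleteSpace E]

/-- The clamp `t ↦ max l (min t r)` onto `[l, r]` (the projection `π_{[l,r]}` when `l ≤ r`). [folklore] -/
def cfClamp (l r t : ℝ) : ℝ := max l (min t r)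

/-- The clamp is `1`-Lipschitz. [folklore] -/
theorem abs_cfClamp_sub_le (l r x y : ℝ) : |cfClamp l r x - cfClamp l r y| ≤ |x - y| := by
  unfold cfClamp
  calc |max l (min x r) - max l (min y r)| ≤ max |l - l| |min x r - min y r| := abs_max_sub_max_le_max _ _ _ _
    _ ≤ max |l - l| (max |x - y| |r - r|) := max_le_max le_rfl (abs_min_sub_min_le_max _ _ _ _)
    _ = |x - y| := by simp [abs_nonneg]

/-- The clamp lands in `[l, r]` (`l ≤ r`). [folklore] -/
theorem cfClamp_mem {l r : ℝ} (hlr : l ≤ r) (t : ℝ) : cfClamp l r t ∈ Icc l r :=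
  ⟨le_max_left _ _, max_le hlr (min_le_right _ _)⟩

/-- The clamp fixes `[l, r]`. [folklore] -/
theorem cfClamp_of_mem {l r t : ℝ} (ht : t ∈ Icc l r) : cfClamp l r t = t := by
  unfold cfClamp
  rw [min_eq_left ht.2, max_eq_right ht.1]

/-- The Steklov average `x ↦ ε⁻¹ ∫_x^{x+ε} f(π_{[l,r]}(t)) dt` (`π` the clamp onto `[l,r]`),
written with the primitive `P(u) = ∫_0^u f ∘ π`. [folklore] -/
def steklov (l r : ℝ) (f : ℝ → E) (ε : ℝ) (x : ℝ) : E :=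
  ε⁻¹ • ((∫ t in (0 : ℝ)..(x + ε), f (cfClamp l r t)) - ∫ t in (0 : ℝ)..x, f (cfClamp l r t))

variable {l r : ℝ} (hlr : l ≤ r) {f : ℝ → E} {M L : ℝ}

omit [NormedSpace ℝ E] [CompleteSpace E] in
include hlr in
/-- `f ∘ π_{[l,r]}` is `L`-Lipschitz on `ℝ` when `f` is `L`-Lipschitz on `[l,r]`. [folklore] -/
theorem norm_comp_cfClamp_sub_le (hL : ∀ x ∈ Icc l r, ∀ y ∈ Icc l r, ‖f x - f y‖ ≤ L * |x - y|) (hL0 : 0 ≤ L)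
    (x y : ℝ) : ‖f (cfClamp l r x) - f (cfClamp l r y)‖ ≤ L * |x - y| :=
  (hL _ (cfClamp_mem hlr x) _ (cfClamp_mem hlr y)).trans (mul_le_mul_of_nonneg_left (abs_cfClamp_sub_le l r x y) hL0)

omit [NormedSpace ℝ E] [CompleteSpace E] in
include hlr in
/-- `f ∘ π_{[l,r]}` is continuous when `f` is Lipschitz on `[l,r]`. [folklore] -/
theorem continuous_comp_cfClamp (hL : ∀ x ∈ Icc l r, ∀ y ∈ Icc l r, ‖f x - f y‖ ≤ L * |x - y|) (hL0 : 0 ≤ L) :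
    Continuous fun t => f (cfClamp l r t) := by
  have hlip : LipschitzWith (Real.toNNReal L) fun t => f (cfClamp l r t) := by
    refine LipschitzWith.of_dist_le_mul fun x y => ?_
    rw [dist_eq_norm, Real.dist_eq, Real.coe_toNNReal _ hL0]
    exact norm_comp_cfClamp_sub_le hlr hL hL0 x y
  exact hlip.continuous

include hlr in
/-- **Derivative of the Steklov average:** `(ε⁻¹ ∫_x^{x+ε} g)' = ε⁻¹ (g(x+ε) - g(x))` for continuous `g`.
[folklore] -/
theorem hasDerivAt_steklov (hL : ∀ x ∈ Icc l r, ∀ y ∈ Icc l r, ‖f x - f y‖ ≤ L * |x - y|) (hL0 : 0 ≤ L)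
    (ε x : ℝ) :
    HasDerivAt (steklov l r f ε) (ε⁻¹ • (f (cfClamp l r (x + ε)) - f (cfClamp l r x))) x := by
  have hg := continuous_comp_cfClamp hlr hL hL0
  have h1 : HasDerivAt (fun u => ∫ t in (0 : ℝ)..u, f (cfClamp l r t)) (f (cfClamp l r (x + ε))) (x + ε) :=
    (hg.integral_hasStrictDerivAt 0 (x + ε)).hasDerivAt
  have h1' : HasDerivAt (fun y => ∫ t in (0 : ℝ)..(y + ε), f (cfClamp l r t)) (f (cfClamp l r (x + ε))) x := by
    simpa using h1.comp_add_const x ε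
  have h2 : HasDerivAt (fun u => ∫ t in (0 : ℝ)..u, f (cfClamp l r t)) (f (cfClamp l r x)) x :=
    (hg.integral_hasStrictDerivAt 0 x).hasDerivAt
  exact (h1'.sub h2).const_smul ε⁻¹

include hlr in
/-- The Steklov average is `C¹` on `ℝ`. [folklore] -/
theorem contDiff_steklov (hL : ∀ x ∈ Icc l r, ∀ y ∈ Icc l r, ‖f x - f y‖ ≤ L * |x - y|) (hL0 : 0 ≤ L) (ε : ℝ) :
    ContDiff ℝ 1 (steklov l r f ε) := by
  rw [contDiff_one_iff_deriv]
  refine ⟨fun x => (hasDerivAt_steklov hlr hL hL0 ε x).differentiableAt, ?_⟩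
  have hd : deriv (steklov l r f ε) = fun x => ε⁻¹ • (f (cfClamp l r (x + ε)) - f (cfClamp l r x)) :=
    funext fun x => (hasDerivAt_steklov hlr hL hL0 ε x).deriv
  rw [hd]
  have hg := continuous_comp_cfClamp hlr hL hL0
  exact ((hg.comp (continuous_id.add continuous_const)).sub hg).const_smul _

include hlr in
/-- **Derivative bound:** `‖(steklov f ε)'‖ ≤ L` (`ε > 0`). [folklore] -/
theorem norm_deriv_steklov_le (hL : ∀ x ∈ Icc l r, ∀ y ∈ Icc l r, ‖f x - f y‖ ≤ L * |x - y|) (hL0 : 0 ≤ L)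
    {ε : ℝ} (hε : 0 < ε) (x : ℝ) : ‖deriv (steklov l r f ε) x‖ ≤ L := by
  rw [(hasDerivAt_steklov hlr hL hL0 ε x).deriv, norm_smul, norm_inv, Real.norm_eq_abs, abs_of_pos hε]
  have h := norm_comp_cfClamp_sub_le hlr hL hL0 (x + ε) x
  rw [show x + ε - x = ε by ring, abs_of_pos hε] at h
  calc ε⁻¹ * ‖f (cfClamp l r (x + ε)) - f (cfClamp l r x)‖ ≤ ε⁻¹ * (L * ε) :=
        mul_le_mul_of_nonneg_left h (inv_nonneg.2 hε.le)
    _ = L := by field_simp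

omit [CompleteSpace E] in
include hlr in
/-- **Sup bound:** `‖steklov f ε x‖ ≤ M` if `‖f‖ ≤ M` on `[l,r]` (`ε > 0`). [folklore] -/
theorem norm_steklov_le (hL : ∀ x ∈ Icc l r, ∀ y ∈ Icc l r, ‖f x - f y‖ ≤ L * |x - y|) (hL0 : 0 ≤ L)
    (hM : ∀ x ∈ Icc l r, ‖f x‖ ≤ M) {ε : ℝ} (hε : 0 < ε) (x : ℝ) : ‖steklov l r f ε x‖ ≤ M := by
  have hg := continuous_comp_cfClamp hlr hL hL0
  have hint : ∀ a b : ℝ, IntervalIntegrable (fun t => f (cfClamp l r t)) volume a b :=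
    fun a b => hg.intervalIntegrable a b
  rw [steklov, integral_interval_sub_left (hint 0 (x + ε)) (hint 0 x), norm_smul, norm_inv, Real.norm_eq_abs,
    abs_of_pos hε]
  have hb : ‖∫ t in x..(x + ε), f (cfClamp l r t)‖ ≤ M * |x + ε - x| :=
    norm_integral_le_of_norm_le_const fun t _ => hM _ (cfClamp_mem hlr t)
  rw [show x + ε - x = ε by ring, abs_of_pos hε] at hb
  calc ε⁻¹ * ‖∫ t in x..(x + ε), f (cfClamp l r t)‖ ≤ ε⁻¹ * (M * ε) := mul_le_mul_of_nonneg_left hb (inv_nonneg.2 hε.le)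
    _ = M := by field_simp

include hlr in
/-- **Approximation:** `‖steklov f ε x - f x‖ ≤ L ε` for `x ∈ [l,r]` (`ε > 0`). [folklore] -/
theorem norm_steklov_sub_le (hL : ∀ x ∈ Icc l r, ∀ y ∈ Icc l r, ‖f x - f y‖ ≤ L * |x - y|) (hL0 : 0 ≤ L)
    {ε : ℝ} (hε : 0 < ε) {x : ℝ} (hx : x ∈ Icc l r) : ‖steklov l r f ε x - f x‖ ≤ L * ε := by
  have hg := continuous_comp_cfClamp hlr hL hL0
  have hint : ∀ a b : ℝ, IntervalIntegrable (fun t => f (cfClamp l r t)) volume a b :=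
    fun a b => hg.intervalIntegrable a b
  have hfx : f x = ε⁻¹ • ∫ _t in x..(x + ε), f x := by
    rw [intervalIntegral.integral_const, show x + ε - x = ε by ring, ← smul_assoc, smul_eq_mul, inv_mul_cancel₀ hε.ne', one_smul]
  rw [steklov, integral_interval_sub_left (hint 0 (x + ε)) (hint 0 x), hfx, ← smul_sub,
    ← intervalIntegral.integral_sub (hint x (x + ε)) intervalIntegrable_const, norm_smul, norm_inv, Real.norm_eq_abs,
    abs_of_pos hε]
  have hb : ‖∫ t in x..(x + ε), (f (cfClamp l r t) - f x)‖ ≤ (L * ε) * |x + ε - x| := by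
    refine norm_integral_le_of_norm_le_const fun t ht => ?_
    rw [uIoc_of_le (by linarith)] at ht
    have h := norm_comp_cfClamp_sub_le hlr hL hL0 t x
    rw [cfClamp_of_mem hx] at h
    refine h.trans (mul_le_mul_of_nonneg_left ?_ hL0)
    rw [abs_le]; constructor <;> linarith [ht.1, ht.2]
  rw [show x + ε - x = ε by ring, abs_of_pos hε] at hb
  calc ε⁻¹ * ‖∫ t in x..(x + ε), (f (cfClamp l r t) - f x)‖ ≤ ε⁻¹ * (L * ε * ε) :=
        mul_le_mul_of_nonneg_left hb (inv_nonneg.2 hε.le)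
    _ = L * ε := by field_simp

include hlr in
/-- A continuous linear constraint `ℓ ∘ f = 0` on `[l,r]` is inherited by the Steklov average. [folklore] -/
theorem apply_steklov_eq_zero {E' : Type*} [NormedAddCommGroup E'] [NormedSpace ℝ E'] [CompleteSpace E']
    (ℓ : E →L[ℝ] E')
    (hL : ∀ x ∈ Icc l r, ∀ y ∈ Icc l r, ‖f x - f y‖ ≤ L * |x - y|) (hL0 : 0 ≤ L)
    (hℓ : ∀ x ∈ Icc l r, ℓ (f x) = 0) (ε x : ℝ) : ℓ (steklov l r f ε x) = 0 := by
  have hg := continuous_comp_cfClamp hlr hL hL0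
  have hint : ∀ a b : ℝ, IntervalIntegrable (fun t => f (cfClamp l r t)) volume a b :=
    fun a b => hg.intervalIntegrable a b
  have hzero : ∀ a b : ℝ, ℓ (∫ t in a..b, f (cfClamp l r t)) = 0 := by
    intro a b
    rw [← ℓ.intervalIntegral_comp_comm (hint a b)]
    simp only [hℓ _ (cfClamp_mem hlr _), intervalIntegral.integral_zero]
  rw [steklov, map_smul, map_sub, hzero, hzero, sub_zero, smul_zero]

end Steklov

/-! ### Cylinderwise Steklov smoothing on `I` -/

section OnI

variable {A : Finset ℕ} (hA : ∀ a ∈ A, 1 ≤ a)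
variable {E : Type*} [NormedAddCommGroup E] [NormedSpace ℝ E] [CompleteSpace E]

/-- Left endpoint of the cylinder `I_{a,a'}`. [cite: MageeOhWinter2019, §2.1 (II)] -/
def cfCylL (A : Finset ℕ) (a a' : ℕ) : ℝ := cfMoeb (cfGen a * cfGen a') (1 / ((cfAmax A : ℝ) + 1))

/-- Right endpoint of the cylinder `I_{a,a'}`. [cite: MageeOhWinter2019, §2.1 (II)] -/
def cfCylR (a a' : ℕ) : ℝ := cfMoeb (cfGen a * cfGen a') 1

/-- `left endpoint ≤ right endpoint`. [folklore] -/
theorem cfCylL_le_cfCylR {a a' : ℕ} (ha : 1 ≤ a) : cfCylL A a a' ≤ cfCylR a a' := by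
  refine cfMoeb_pair_mono ha (cfIA_left_pos A).le ?_
  rw [div_le_one (by positivity)]; linarith [Nat.cast_nonneg (α := ℝ) (cfAmax A)]

/-- The cylinder as the closed interval between its endpoints. [cite: MageeOhWinter2019, §2.1 (II)] -/
theorem cfCyl_eq_Icc' {a a' : ℕ} (ha : 1 ≤ a) : cfCyl A a a' = Icc (cfCylL A a a') (cfCylR a a') :=
  cfCyl_eq_Icc ha

/-- **The cylinderwise Steklov average** of `f` on `I`: on `I_{a,a'}` it is the Steklov average of
`f|_{I_{a,a'}}`; off `I` it is `0`. [folklore] -/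
def cfSteklov (A : Finset ℕ) (f : ℝ → E) (ε : ℝ) (x : ℝ) : E :=
  ∑ p ∈ A ×ˢ A, (cfCyl A p.1 p.2).indicator (steklov (cfCylL A p.1 p.2) (cfCylR p.1 p.2) f ε) x

omit [CompleteSpace E] in
include hA in
/-- On the cylinder `I_{a,a'}` the cylinderwise average is the Steklov average of that cylinder
(the other cylinders are disjoint from it). [folklore] -/
theorem cfSteklov_eq_of_mem {a a' : ℕ} (ha : a ∈ A) (ha' : a' ∈ A) (f : ℝ → E) (ε : ℝ) {x : ℝ}
    (hx : x ∈ cfCyl A a a') : cfSteklov A f ε x = steklov (cfCylL A a a') (cfCylR a a') f ε x := by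
  rw [cfSteklov, Finset.sum_eq_single (a, a')]
  · rw [indicator_of_mem hx]
  · rintro ⟨b, b'⟩ hb hne
    rw [Finset.mem_product] at hb
    rw [indicator_of_notMem]
    exact cfCyl_disjoint (hA a ha) (hA a' ha') (hA b hb.1) (hA b' hb.2) (Ne.symm hne) hx
  · intro h
    exact absurd (Finset.mem_product.2 ⟨ha, ha'⟩) h

omit [CompleteSpace E] in
include hA in
/-- Near a point of `I_{a,a'}`, within `I`, the cylinderwise average agrees with the Steklov average of
that cylinder. [folklore] -/
theorem cfSteklov_eventuallyEq {a a' : ℕ} (ha : a ∈ A) (ha' : a' ∈ A) (f : ℝ → E) (ε : ℝ) {x : ℝ}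
    (hx : x ∈ cfCyl A a a') :
    cfSteklov A f ε =ᶠ[𝓝[cfI A] x] steklov (cfCylL A a a') (cfCylR a a') f ε := by
  rw [nhdsWithin_cfI_eq hA ha ha' hx]
  exact eventually_nhdsWithin_of_forall fun y hy => cfSteklov_eq_of_mem hA ha ha' f ε hy

variable {f : ℝ → E} {M L : ℝ}

include hA in
/-- **The cylinderwise average is `C¹` on `I`.** [folklore] -/
theorem contDiffOn_cfSteklov (hL0 : 0 ≤ L)
    (hL : ∀ a ∈ A, ∀ a' ∈ A, ∀ x ∈ cfCyl A a a', ∀ y ∈ cfCyl A a a', ‖f x - f y‖ ≤ L * |x - y|) (ε : ℝ) :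
    ContDiffOn ℝ 1 (cfSteklov A f ε) (cfI A) := by
  intro x hx
  obtain ⟨a, ha, a', ha', hxc⟩ := mem_cfI.1 hx
  have hL' : ∀ x ∈ Icc (cfCylL A a a') (cfCylR a a'), ∀ y ∈ Icc (cfCylL A a a') (cfCylR a a'),
      ‖f x - f y‖ ≤ L * |x - y| := by
    rw [← cfCyl_eq_Icc' (hA a ha)]; exact hL a ha a' ha'
  have h := (contDiff_steklov (cfCylL_le_cfCylR (hA a ha)) hL' hL0 ε).contDiffAt (x := x)
  exact h.contDiffWithinAt.congr_of_eventuallyEq (cfSteklov_eventuallyEq hA ha ha' f ε hxc)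
    (cfSteklov_eq_of_mem hA ha ha' f ε hxc)

include hA in
/-- The derivative within `I` of the cylinderwise average is the derivative of the cylinder's
Steklov average. [folklore] -/
theorem derivWithin_cfSteklov (hL0 : 0 ≤ L)
    (hL : ∀ a ∈ A, ∀ a' ∈ A, ∀ x ∈ cfCyl A a a', ∀ y ∈ cfCyl A a a', ‖f x - f y‖ ≤ L * |x - y|) (ε : ℝ)
    {a a' : ℕ} (ha : a ∈ A) (ha' : a' ∈ A) {x : ℝ} (hx : x ∈ cfCyl A a a') :
    derivWithin (cfSteklov A f ε) (cfI A) x = deriv (steklov (cfCylL A a a') (cfCylR a a') f ε) x := by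
  have hL' : ∀ x ∈ Icc (cfCylL A a a') (cfCylR a a'), ∀ y ∈ Icc (cfCylL A a a') (cfCylR a a'),
      ‖f x - f y‖ ≤ L * |x - y| := by
    rw [← cfCyl_eq_Icc' (hA a ha)]; exact hL a ha a' ha'
  rw [(cfSteklov_eventuallyEq hA ha ha' f ε hx).derivWithin_eq (cfSteklov_eq_of_mem hA ha ha' f ε hx)]
  exact ((contDiff_steklov (cfCylL_le_cfCylR (hA a ha)) hL' hL0 ε).differentiable one_ne_zero x).derivWithin
    (uniqueDiffOn_cfI hA x (cfCyl_subset_cfI ha ha' hx))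

include hA in
/-- **Bounds for the cylinderwise average** (`ε > 0`): `‖F_ε‖ ≤ M` and `‖F_ε'‖ ≤ L` on `I`, where
`M ≥ sup_I ‖f‖` and `L` is a cylinderwise Lipschitz constant of `f`. [folklore] -/
theorem cfSteklov_bounds (hL0 : 0 ≤ L) (hM : ∀ x ∈ cfI A, ‖f x‖ ≤ M)
    (hL : ∀ a ∈ A, ∀ a' ∈ A, ∀ x ∈ cfCyl A a a', ∀ y ∈ cfCyl A a a', ‖f x - f y‖ ≤ L * |x - y|)
    {ε : ℝ} (hε : 0 < ε) {x : ℝ} (hx : x ∈ cfI A) :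
    ‖cfSteklov A f ε x‖ ≤ M ∧ ‖derivWithin (cfSteklov A f ε) (cfI A) x‖ ≤ L := by
  obtain ⟨a, ha, a', ha', hxc⟩ := mem_cfI.1 hx
  have hL' : ∀ x ∈ Icc (cfCylL A a a') (cfCylR a a'), ∀ y ∈ Icc (cfCylL A a a') (cfCylR a a'),
      ‖f x - f y‖ ≤ L * |x - y| := by
    rw [← cfCyl_eq_Icc' (hA a ha)]; exact hL a ha a' ha'
  have hM' : ∀ x ∈ Icc (cfCylL A a a') (cfCylR a a'), ‖f x‖ ≤ M := by
    rw [← cfCyl_eq_Icc' (hA a ha)]; exact fun y hy => hM y (cfCyl_subset_cfI ha ha' hy)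
  refine ⟨?_, ?_⟩
  · rw [cfSteklov_eq_of_mem hA ha ha' f ε hxc]
    exact norm_steklov_le (cfCylL_le_cfCylR (hA a ha)) hL' hL0 hM' hε x
  · rw [derivWithin_cfSteklov hA hL0 hL ε ha ha' hxc]
    exact norm_deriv_steklov_le (cfCylL_le_cfCylR (hA a ha)) hL' hL0 hε x

include hA in
/-- **Convergence of the cylinderwise averages:** `F_{1/(n+1)}(x) → f(x)` for `x ∈ I`. [folklore] -/
theorem cfSteklov_tendsto (hL0 : 0 ≤ L)
    (hL : ∀ a ∈ A, ∀ a' ∈ A, ∀ x ∈ cfCyl A a a', ∀ y ∈ cfCyl A a a', ‖f x - f y‖ ≤ L * |x - y|)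
    {x : ℝ} (hx : x ∈ cfI A) :
    Tendsto (fun n : ℕ => cfSteklov A f (1 / ((n : ℝ) + 1)) x) atTop (𝓝 (f x)) := by
  obtain ⟨a, ha, a', ha', hxc⟩ := mem_cfI.1 hx
  have hL' : ∀ x ∈ Icc (cfCylL A a a') (cfCylR a a'), ∀ y ∈ Icc (cfCylL A a a') (cfCylR a a'),
      ‖f x - f y‖ ≤ L * |x - y| := by
    rw [← cfCyl_eq_Icc' (hA a ha)]; exact hL a ha a' ha'
  have hxI : x ∈ Icc (cfCylL A a a') (cfCylR a a') := by rw [← cfCyl_eq_Icc' (hA a ha)]; exact hxc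
  rw [tendsto_iff_norm_sub_tendsto_zero]
  have hbound : ∀ n : ℕ, ‖cfSteklov A f (1 / ((n : ℝ) + 1)) x - f x‖ ≤ L * (1 / ((n : ℝ) + 1)) := fun n => by
    rw [cfSteklov_eq_of_mem hA ha ha' f _ hxc]
    exact norm_steklov_sub_le (cfCylL_le_cfCylR (hA a ha)) hL' hL0 (by positivity) hxI
  have hlim : Tendsto (fun n : ℕ => L * (1 / ((n : ℝ) + 1))) atTop (𝓝 0) := by
    simpa using tendsto_one_div_add_atTop_nhds_zero_nat.const_mul L
  exact squeeze_zero (fun n => norm_nonneg _) hbound hlim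

include hA in
/-- A continuous linear constraint `ℓ ∘ f = 0` on `I` is inherited by the cylinderwise averages on `I`.
[folklore] -/
theorem apply_cfSteklov_eq_zero {E' : Type*} [NormedAddCommGroup E'] [NormedSpace ℝ E'] [CompleteSpace E']
    (ℓ : E →L[ℝ] E')
    (hL0 : 0 ≤ L)
    (hL : ∀ a ∈ A, ∀ a' ∈ A, ∀ x ∈ cfCyl A a a', ∀ y ∈ cfCyl A a a', ‖f x - f y‖ ≤ L * |x - y|)
    (hℓ : ∀ x ∈ cfI A, ℓ (f x) = 0) (ε : ℝ) {x : ℝ} (hx : x ∈ cfI A) : ℓ (cfSteklov A f ε x) = 0 := by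
  obtain ⟨a, ha, a', ha', hxc⟩ := mem_cfI.1 hx
  have hL' : ∀ x ∈ Icc (cfCylL A a a') (cfCylR a a'), ∀ y ∈ Icc (cfCylL A a a') (cfCylR a a'),
      ‖f x - f y‖ ≤ L * |x - y| := by
    rw [← cfCyl_eq_Icc' (hA a ha)]; exact hL a ha a' ha'
  have hℓ' : ∀ x ∈ Icc (cfCylL A a a') (cfCylR a a'), ℓ (f x) = 0 := by
    rw [← cfCyl_eq_Icc' (hA a ha)]; exact fun y hy => hℓ y (cfCyl_subset_cfI ha ha' hy)
  rw [cfSteklov_eq_of_mem hA ha ha' f ε hxc]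
  exact apply_steklov_eq_zero (cfCylL_le_cfCylR (hA a ha)) ℓ hL' hL0 hℓ' ε x

end OnI

/-! ### `𝓛_{s,q}` preserves `C¹(I; ℂ^{Γ_q})` -/

section Smooth

variable {A : Finset ℕ} (hA : ∀ a ∈ A, 1 ≤ a) {q : ℕ} [NeZero q]

/-- The weight `x ↦ denom(M,x)^{-2s}` is smooth (in the real variable) wherever the denominator is
positive. [folklore] -/
theorem contDiffAt_cfWt (s : ℂ) (M : Matrix (Fin 2) (Fin 2) ℤ) {x : ℝ} (hx : 0 < cfDenom M x) {n : WithTop ℕ∞} :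
    ContDiffAt ℝ n (fun y => cfWt s M y) x := by
  unfold cfWt
  have hden : ContDiffAt ℝ n (fun y => cfDenom M y) x := by
    unfold cfDenom
    exact (contDiffAt_const.mul contDiffAt_id).add contDiffAt_const
  have hlog : ContDiffAt ℝ n (fun y => Real.log (cfDenom M y)) x := hden.log hx.ne'
  have hof : ContDiffAt ℝ n (fun y => ((Real.log (cfDenom M y) : ℝ) : ℂ)) x :=
    (Complex.ofRealCLM.contDiff.contDiffAt).comp x hlog
  have harg : ContDiffAt ℝ n (fun y => -(2 * s * ((Real.log (cfDenom M y) : ℝ) : ℂ))) x :=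
    (contDiffAt_const.mul hof).neg
  exact ((Complex.contDiff_exp (𝕜 := ℝ)).contDiffAt).comp x harg

/-- The branch `x ↦ g_a g_{a'} x` is smooth on `x ≥ 0`. [folklore] -/
theorem contDiffAt_cfMoeb_pair (a a' : ℕ) {x : ℝ} (hx : 0 ≤ x) {n : WithTop ℕ∞} :
    ContDiffAt ℝ n (cfMoeb (cfGen a * cfGen a')) x := by
  have hd : 0 < cfDenom (cfGen a * cfGen a') x := lt_of_lt_of_le one_pos (one_le_cfDenom_pair a a' hx)
  unfold cfMoeb
  refine ContDiffAt.div ?_ ?_ (by simpa [cfDenom] using hd.ne')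
  · exact (contDiffAt_const.mul contDiffAt_id).add contDiffAt_const
  · exact (contDiffAt_const.mul contDiffAt_id).add contDiffAt_const

/-- **`𝓛_{s,q}` maps `C¹(I)` into `C¹(I_A)`** (hence into `C¹(I)`): each branch `g_i` is smooth and maps
`I_A` into `I_i ⊆ I`, the weights are smooth, `ρ(g_i)` is linear. [cite: MageeOhWinter2019, §2.2] -/
theorem contDiffOn_cfCongL_cfIA (s : ℂ) {F : ℝ → CfVec q} {n : WithTop ℕ∞} (hF : ContDiffOn ℝ n F (cfI A)) :
    ContDiffOn ℝ n (cfCongL A q s F) (cfIA A) := by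
  have e : cfCongL A q s F = fun x => ∑ p ∈ A ×ˢ A,
      cfWt s (cfGen p.1 * cfGen p.2) x • cfRepL (cfRed q (cfPair p.1 p.2)) (F (cfMoeb (cfGen p.1 * cfGen p.2) x)) := by
    funext x
    rw [cfCongL, Finset.sum_product]
    rfl
  rw [e]
  refine ContDiffOn.sum fun p hp => ?_
  rw [Finset.mem_product] at hp
  have hα := (cfIA_left_pos A).le
  refine ContDiffOn.smul (fun x hx => (contDiffAt_cfWt s _ (lt_of_lt_of_le one_pos
    (one_le_cfDenom_pair p.1 p.2 (hα.trans hx.1)))).contDiffWithinAt) ?_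
  have hcomp : ContDiffOn ℝ n (F ∘ cfMoeb (cfGen p.1 * cfGen p.2)) (cfIA A) :=
    hF.comp (fun x hx => (contDiffAt_cfMoeb_pair p.1 p.2 (hα.trans hx.1)).contDiffWithinAt)
      fun x hx => cfCyl_subset_cfI hp.1 hp.2 (cfMoeb_pair_mem_cfCyl p.1 p.2 hx)
  exact ((cfRepL (cfRed q (cfPair p.1 p.2))).restrictScalars ℝ).contDiff.comp_contDiffOn hcomp

include hA in
/-- `𝓛_{s,q}` preserves `C¹(I; ℂ^{Γ_q})`. [cite: MageeOhWinter2019, §2.2] -/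
theorem contDiffOn_cfCongL (s : ℂ) {F : ℝ → CfVec q} {n : WithTop ℕ∞} (hF : ContDiffOn ℝ n F (cfI A)) :
    ContDiffOn ℝ n (cfCongL A q s F) (cfI A) :=
  (contDiffOn_cfCongL_cfIA s hF).mono (cfI_subset_cfIA hA)

include hA in
/-- The iterates `𝓛^m_{s,q}` preserve `C¹(I; ℂ^{Γ_q})`. [cite: MageeOhWinter2019, §2.2] -/
theorem contDiffOn_cfCongL_iterate (s : ℂ) (m : ℕ) {F : ℝ → CfVec q} {n : WithTop ℕ∞}
    (hF : ContDiffOn ℝ n F (cfI A)) : ContDiffOn ℝ n ((cfCongL A q s)^[m] F) (cfI A) := by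
  induction m with
  | zero => exact hF
  | succ m ih => rw [Function.iterate_succ_apply']; exact contDiffOn_cfCongL hA s ih

/-- `I` is compact. [folklore] -/
theorem isCompact_cfI (hA : ∀ a ∈ A, 1 ≤ a) : IsCompact (cfI A) := by
  refine A.isCompact_biUnion fun a ha => A.isCompact_biUnion fun a' _ => ?_
  rw [cfCyl_eq_Icc (hA a ha)]; exact isCompact_Icc

include hA in
/-- For `G ∈ C¹(I)` both suprema in `‖G‖_{C¹(I)}` are genuine (bounded ranges). [folklore] -/
theorem bddAbove_of_contDiffOn {G : ℝ → CfVec q} (hG : ContDiffOn ℝ 1 G (cfI A)) :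
    BddAbove (range fun x : cfI A => ‖G x‖) ∧ BddAbove (range fun x : cfI A => ‖derivWithin G (cfI A) x‖) := by
  have hK := isCompact_cfI hA
  constructor
  · have hc : ContinuousOn (fun x => ‖G x‖) (cfI A) := hG.continuousOn.norm
    have := (hK.image_of_continuousOn hc).bddAbove
    rwa [image_eq_range] at this
  · have hc : ContinuousOn (fun x => ‖derivWithin G (cfI A) x‖) (cfI A) :=
      (hG.continuousOn_derivWithin (uniqueDiffOn_cfI hA) le_rfl).norm
    have := (hK.image_of_continuousOn hc).bddAbove
    rwa [image_eq_range] at this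

include hA in
/-- The cylinder and `I` agree near each point of the cylinder. [folklore] -/
theorem cfCyl_eventuallyEq_cfI {a a' : ℕ} (ha : a ∈ A) (ha' : a' ∈ A) {x : ℝ} (hx : x ∈ cfCyl A a a') :
    (cfCyl A a a' : Set ℝ) =ᶠ[𝓝 x] cfI A :=
  (nhdsWithin_eq_iff_eventuallyEq.1 (nhdsWithin_cfI_eq hA ha ha' hx)).symm

include hA in
/-- **Mean value on a cylinder:** a `C¹(I)` function with `‖G'‖ ≤ C` on `I` is `C`-Lipschitz on each
cylinder. [folklore] -/
theorem norm_sub_le_of_c1 {G : ℝ → CfVec q} (hG : ContDiffOn ℝ 1 G (cfI A)) {C : ℝ}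
    (hC : ∀ x ∈ cfI A, ‖derivWithin G (cfI A) x‖ ≤ C) {a a' : ℕ} (ha : a ∈ A) (ha' : a' ∈ A)
    {x y : ℝ} (hx : x ∈ cfCyl A a a') (hy : y ∈ cfCyl A a a') : ‖G x - G y‖ ≤ C * |x - y| := by
  have hsub := cfCyl_subset_cfI (A := A) ha ha'
  have hdiff : DifferentiableOn ℝ G (cfCyl A a a') := (hG.mono hsub).differentiableOn one_ne_zero
  have hbound : ∀ z ∈ cfCyl A a a', ‖derivWithin G (cfCyl A a a') z‖ ≤ C := fun z hz => by
    rw [derivWithin_congr_set (cfCyl_eventuallyEq_cfI hA ha ha' hz)]; exact hC z (hsub hz)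
  have hconv : Convex ℝ (cfCyl A a a') := by rw [cfCyl_eq_Icc (hA a ha)]; exact convex_Icc _ _
  have h := hconv.norm_image_sub_le_of_norm_derivWithin_le hdiff hbound hy hx
  rwa [Real.norm_eq_abs] at h

include hA in
/-- **Pointwise continuity of the iterates:** if `F_n → f` pointwise on `I` then `𝓛^m F_n → 𝓛^m f`
pointwise on `I`. [folklore] -/
theorem tendsto_cfCongL_iterate (s : ℂ) {F : ℕ → ℝ → CfVec q} {f : ℝ → CfVec q}
    (h : ∀ x ∈ cfI A, Tendsto (fun n => F n x) atTop (𝓝 (f x))) (m : ℕ) {x : ℝ} (hx : x ∈ cfI A) :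
    Tendsto (fun n => (cfCongL A q s)^[m] (F n) x) atTop (𝓝 ((cfCongL A q s)^[m] f x)) := by
  induction m generalizing x with
  | zero => exact h x hx
  | succ m ih =>
    simp only [Function.iterate_succ_apply']
    unfold cfCongL
    refine tendsto_finsetSum _ fun a ha => tendsto_finsetSum _ fun a' ha' => ?_
    have hy : cfMoeb (cfGen a * cfGen a') x ∈ cfI A :=
      cfCyl_subset_cfI ha ha' (cfMoeb_pair_mem_cfCyl a a' (cfI_subset_cfIA hA hx))
    exact (((continuous_cfRep _).tendsto _).comp (ih hy)).const_smul _

end Smooth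

/-! ### From `C¹` operator bounds to piecewise Lipschitz bounds -/

section Transfer

variable {A : Finset ℕ} (hA : ∀ a ∈ A, 1 ≤ a) {q : ℕ} [NeZero q]
variable {E' : Type*} [NormedAddCommGroup E'] [NormedSpace ℝ E'] [CompleteSpace E']

include hA in
/-- **`C¹(I)` operator bounds give piecewise Lipschitz bounds.** Let `ℓ` be a continuous linear map
(the constraint `ℓ ∘ F = 0` encodes e.g. "values in `ℂ^{Γ_q} ⊖ 1`"; take `ℓ = 0` for no constraint).
If `‖𝓛^m_{s,q} F‖_{C¹(I)} ≤ B ‖F‖_{C¹(I)}` for every `F ∈ C¹(I; ℂ^{Γ_q})` with `ℓ ∘ F = 0` on `I`, then for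
every `f` with `sup_I ‖f‖ ≤ M`, cylinderwise `L`-Lipschitz and `ℓ ∘ f = 0` on `I`:
`sup_I ‖𝓛^m f‖ ≤ B (M + L)` and `𝓛^m f` is cylinderwise `B (M + L)`-Lipschitz (Steklov smoothing,
the mean value theorem on each cylinder, and pointwise limits). [cite: MageeOhWinter2019, Thm. 4 and eq. (2.3)] -/
theorem cfCongL_iterate_pLip_of_c1 (ℓ : CfVec q →L[ℝ] E') (s : ℂ) (m : ℕ) {B : ℝ} (hB : 0 ≤ B)
    (hΛ : ∀ F : ℝ → CfVec q, ContDiffOn ℝ 1 F (cfI A) → (∀ x ∈ cfI A, ℓ (F x) = 0) →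
      c1NormOn (cfI A) ((cfCongL A q s)^[m] F) ≤ B * c1NormOn (cfI A) F)
    {f : ℝ → CfVec q} {M L : ℝ} (hM0 : 0 ≤ M) (hL0 : 0 ≤ L) (hfM : ∀ x ∈ cfI A, ‖f x‖ ≤ M)
    (hfL : ∀ a ∈ A, ∀ a' ∈ A, ∀ x ∈ cfCyl A a a', ∀ y ∈ cfCyl A a a', ‖f x - f y‖ ≤ L * |x - y|)
    (hfℓ : ∀ x ∈ cfI A, ℓ (f x) = 0) :
    (∀ x ∈ cfI A, ‖(cfCongL A q s)^[m] f x‖ ≤ B * (M + L)) ∧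
    (∀ a ∈ A, ∀ a' ∈ A, ∀ x ∈ cfCyl A a a', ∀ y ∈ cfCyl A a a',
      ‖(cfCongL A q s)^[m] f x - (cfCongL A q s)^[m] f y‖ ≤ B * (M + L) * |x - y|) := by
  -- the smoothed functions and their images
  set F : ℕ → ℝ → CfVec q := fun n => cfSteklov A f (1 / ((n : ℝ) + 1)) with hF
  set Λ : (ℝ → CfVec q) → (ℝ → CfVec q) := fun G => (cfCongL A q s)^[m] G with hΛdef
  have hε : ∀ n : ℕ, (0 : ℝ) < 1 / ((n : ℝ) + 1) := fun n => by positivity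
  have hFcd : ∀ n, ContDiffOn ℝ 1 (F n) (cfI A) := fun n => contDiffOn_cfSteklov hA hL0 hfL _
  have hFbd : ∀ n, ∀ x ∈ cfI A, ‖F n x‖ ≤ M ∧ ‖derivWithin (F n) (cfI A) x‖ ≤ L :=
    fun n x hx => cfSteklov_bounds hA hL0 hfM hfL (hε n) hx
  have hFℓ : ∀ n, ∀ x ∈ cfI A, ℓ (F n x) = 0 := fun n x hx => apply_cfSteklov_eq_zero hA ℓ hL0 hfL hfℓ _ hx
  have hFc1 : ∀ n, c1NormOn (cfI A) (F n) ≤ M + L :=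
    fun n => c1NormOn_le_of_bounds hM0 hL0 (fun x hx => (hFbd n x hx).1) (fun x hx => (hFbd n x hx).2)
  have hGcd : ∀ n, ContDiffOn ℝ 1 (Λ (F n)) (cfI A) := fun n => contDiffOn_cfCongL_iterate hA s m (hFcd n)
  have hGc1 : ∀ n, c1NormOn (cfI A) (Λ (F n)) ≤ B * (M + L) :=
    fun n => (hΛ (F n) (hFcd n) (hFℓ n)).trans (mul_le_mul_of_nonneg_left (hFc1 n) hB)
  have hGsup : ∀ n, ∀ x ∈ cfI A, ‖Λ (F n) x‖ ≤ B * (M + L) := fun n x hx =>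
    (norm_le_c1NormOn (bddAbove_of_contDiffOn hA (hGcd n)).1 hx).trans (hGc1 n)
  have hGder : ∀ n, ∀ x ∈ cfI A, ‖derivWithin (Λ (F n)) (cfI A) x‖ ≤ B * (M + L) := fun n x hx =>
    (norm_derivWithin_le_c1NormOn (bddAbove_of_contDiffOn hA (hGcd n)).2 hx).trans (hGc1 n)
  have hGlip : ∀ n, ∀ a ∈ A, ∀ a' ∈ A, ∀ x ∈ cfCyl A a a', ∀ y ∈ cfCyl A a a',
      ‖Λ (F n) x - Λ (F n) y‖ ≤ B * (M + L) * |x - y| :=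
    fun n a ha a' ha' x hx y hy => norm_sub_le_of_c1 hA (hGcd n) (hGder n) ha ha' hx hy
  -- pointwise limits
  have hconv : ∀ x ∈ cfI A, Tendsto (fun n => F n x) atTop (𝓝 (f x)) := fun x hx => cfSteklov_tendsto hA hL0 hfL hx
  have hlim : ∀ x ∈ cfI A, Tendsto (fun n => Λ (F n) x) atTop (𝓝 (Λ f x)) :=
    fun x hx => tendsto_cfCongL_iterate hA s hconv m hx
  refine ⟨fun x hx => ?_, fun a ha a' ha' x hx y hy => ?_⟩
  · exact le_of_tendsto ((hlim x hx).norm) (Eventually.of_forall fun n => hGsup n x hx)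
  · have hxI := cfCyl_subset_cfI ha ha' hx
    have hyI := cfCyl_subset_cfI ha ha' hy
    exact le_of_tendsto (((hlim x hxI).sub (hlim y hyI)).norm) (Eventually.of_forall fun n => hGlip n a ha a' ha' x hx y hy)

end Transfer

end Literature.NumberTheory.Sieve
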